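import Summits.AtomisticToContinuum.HydrodynamicLimit.Theorems.BoxDissipativeWeakStrongRelativeEnergyStabilityGronwallObsMeas
import Summits.AtomisticToContinuum.HydrodynamicLimit.Theorems.BoxDissipativeWeakStrongEntropyAdmissibilityStubDynPartIntegrable
import HarnessLib

/-!
# Crux `RelativeEnergyStability` (stmt-AtomisticToContinuum-17653), line `registered`, heart stub S-X —
# expectation layer (E1)–(E4): integrability, measurability of the mean, Fubini

Registered sub-goals of the heart stub S-X. For the pathwise clamped box relative energy
`e(s, z) = clampedRelEnergyObs σ η₁ a b ρ u θ N Φ l s z = ∫ ℰ_{Z_{a,b}}(Û(Φ_s z)(x) | (ρ,u,θ)(s,x)) dx` the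
Grönwall function of the lead is `f_N(t) = ∫ F(t, z) dP_N(z)` with
`F(t, z) = ∫ ℰ_Z(Û(Ψ(πt, z))(x) | (ρ,u,θ)(πt, x)) dx`, `πt = max 0 (min t τ)`, where `Ψ` is a jointly measurable
version of the flow (`Ψ(t, z) = Φ_t z` on the good set) and `P_N = localGibbsLaw σ a₀ u₀ θ₀ N Φ`. Given the joint
measurability of `F` (`sx_measurable_obsPsi`, file `…GronwallObsMeas`) and the sharp domination
`|e(s, z)| ≤ A + B · KE(z)/(N+1)` for good `z` and `s ∈ [0, τ]` (a hypothesis here; `sx_obs_abs_le` of the lead),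
we prove:
* (E1) `sx_integrable_obs`: `e(s, ·) ∈ L¹(P_N)` for `s ∈ [0, τ]`;
* (E2) `sx_measurable_mean`: `t ↦ ∫ F(t, z) dP_N(z)` is measurable;
* (E3) `sx_fubini_obs`: `E_P ∫_{(0,t']} e(s, ·) ds = ∫_{(0,t']} E_P F(s, ·) ds` for `t' ∈ [0, τ]`;
* (E4) `sx_integrable_timeIntegral_obs`: `z ↦ ∫_{(0,t']} e(s, z) ds ∈ L¹(P_N)`.

Proofs (measure theory only). On the good set and for `s ∈ [0, τ]`, `F(s, z) = e(s, z)` (`ex_obsPsi_eq`); the good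
set is conull for `P_N` (`P_N ≪ Liouville`, `HardSphereFlow.measure_compl_good`), `P_N` is a probability measure for
`σ ≤ 1/2`, and the kinetic energy is `P_N`-integrable (`EABirthS1a.integrable_configEnergy_localGibbsLaw`), so the
dominating function `z ↦ A + B · KE(z)/(N+1)` is integrable (`ex_integrable_dom`). The three statements are then
instances of abstract lemmas over a measure `P` with a conull set `g`, a jointly measurable `G : ℝ × α → ℝ` agreeing
with `e` on `g × [0, τ]` and an integrable dominating `D`:
`ex_integrable_slice` (`Integrable.mono'`), `ex_integral_integral_swap_Ioc` (`integral_integral_swap` on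
`P ⊗ vol|_{(0,t']}`, domination by `D ∘ fst` via `Integrable.comp_fst`, the a.e. identification transported by
`quasiMeasurePreserving_fst/snd`) and `ex_integrable_setIntegral_Ioc` (`StronglyMeasurable.integral_prod_left'`,
`norm_setIntegral_le_of_norm_le_const`). (E2) is `StronglyMeasurable.integral_prod_right'`.

References: J. Březina, E. Feireisl, J. Math. Soc. Japan 70 (2018) §3.1–3.2 (the quantity); measure theory only.
-/

noncomputable section

namespace Summit.AtomisticToContinuum.HydrodynamicLimit.Theorems.RES

open MeasureTheory Filter Set Function
open scoped Topology InnerProductSpace ENNReal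
open Summit.AtomisticToContinuum.HydrodynamicLimit.Theses.BoxDissipativeWeakStrong
open Literature.MathematicalPhysics.KineticTheory Literature.Analysis.FluidPDE Literature.Analysis.FunctionSpaces
open Literature.Analysis.FluidPDE.CompressibleEuler
open Literature.Analysis.FluidPDE.CompressibleEuler.EulerPhase
open Literature.Analysis.FluidPDE.CompressibleEuler.StrongPointData

section Expect

variable {η₀ η₁ η₁B σ T : ℝ} {F χ f : ℝ → ℝ} {ρ θ : ℝ → T3 → ℝ} {u : ℝ → T3 → V3}

/-! ### Abstract layer: a conull set `g`, a jointly measurable version `G`, an integrable dominating `D` -/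

/-- **Integrability of a time slice.** If `G : ℝ × α → ℝ` is measurable, agrees with `e` on `[0,τ] × g` for a
`P`-conull set `g`, and `|e(s, z)| ≤ D z` there with `D ∈ L¹(P)`, then `e(s, ·) ∈ L¹(P)` for `s ∈ [0, τ]`. -/
theorem ex_integrable_slice {α : Type*} [MeasurableSpace α] {P : Measure α} {g : Set α} (hg : P gᶜ = 0)
    {e : ℝ → α → ℝ} {G : ℝ × α → ℝ} {D : α → ℝ} (hG : Measurable G) {τ : ℝ}
    (heq : ∀ z ∈ g, ∀ s ∈ Icc 0 τ, G (s, z) = e s z) (hD : Integrable D P)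
    (hdom : ∀ z ∈ g, ∀ s ∈ Icc 0 τ, |e s z| ≤ D z) {s : ℝ} (hs : s ∈ Icc 0 τ) :
    Integrable (e s) P := by
  have hae : ∀ᵐ z ∂P, z ∈ g := by rw [ae_iff]; exact hg
  refine hD.mono' ((hG.comp (measurable_prodMk_left (x := s))).aestronglyMeasurable.congr ?_) ?_
  · filter_upwards [hae] with z hz using heq z hz s hs
  · filter_upwards [hae] with z hz
    rw [Real.norm_eq_abs]
    exact hdom z hz s hs

/-- **Fubini on `P ⊗ vol|_{(0,t']}`.** Under the hypotheses of `ex_integrable_slice` (with `P` s-finite),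
`∫ (∫_{(0,t']} e(s, z) ds) dP(z) = ∫_{(0,t']} (∫ G(s, z) dP(z)) ds` for `t' ∈ [0, τ]`: the inner integrands agree
a.e. (`g` conull, `(0,t'] ⊆ [0,τ]`), and `(z, s) ↦ G(s, z)` is integrable on the product, being measurable and
dominated a.e. by the integrable `D ∘ fst` (`Integrable.comp_fst`). -/
theorem ex_integral_integral_swap_Ioc {α : Type*} [MeasurableSpace α] {P : Measure α} [SFinite P] {g : Set α}
    (hg : P gᶜ = 0) {e : ℝ → α → ℝ} {G : ℝ × α → ℝ} {D : α → ℝ} (hG : Measurable G) {τ : ℝ}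
    (heq : ∀ z ∈ g, ∀ s ∈ Icc 0 τ, G (s, z) = e s z) (hD : Integrable D P)
    (hdom : ∀ z ∈ g, ∀ s ∈ Icc 0 τ, |e s z| ≤ D z) {t' : ℝ} (ht' : t' ∈ Icc 0 τ) :
    ∫ z, (∫ s in Ioc 0 t', e s z) ∂P = ∫ s in Ioc 0 t', ∫ z, G (s, z) ∂P := by
  have hae : ∀ᵐ z ∂P, z ∈ g := by rw [ae_iff]; exact hg
  have hsub : ∀ s ∈ Ioc 0 t', s ∈ Icc 0 τ := fun s hs => ⟨hs.1.le, hs.2.trans ht'.2⟩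
  have h1 : ∫ z, (∫ s in Ioc 0 t', e s z) ∂P = ∫ z, (∫ s in Ioc 0 t', G (s, z)) ∂P := by
    refine integral_congr_ae ?_
    filter_upwards [hae] with z hz
    exact setIntegral_congr_fun measurableSet_Ioc fun s hs => (heq z hz s (hsub s hs)).symm
  rw [h1]
  have hint : Integrable (uncurry fun z s => G (s, z)) (P.prod (volume.restrict (Ioc 0 t'))) := by
    refine (hD.comp_fst (volume.restrict (Ioc 0 t'))).mono'
      (hG.comp measurable_swap).aestronglyMeasurable ?_
    have h2 : ∀ᵐ p ∂(P.prod (volume.restrict (Ioc 0 t'))), p.1 ∈ g :=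
      (Measure.quasiMeasurePreserving_fst (μ := P) (ν := volume.restrict (Ioc 0 t'))).ae hae
    have h3 : ∀ᵐ p ∂(P.prod (volume.restrict (Ioc 0 t'))), p.2 ∈ Ioc 0 t' :=
      (Measure.quasiMeasurePreserving_snd (μ := P) (ν := volume.restrict (Ioc 0 t'))).ae
        (ae_restrict_mem measurableSet_Ioc)
    filter_upwards [h2, h3] with p hp hp'
    show ‖G (p.2, p.1)‖ ≤ D p.1
    rw [Real.norm_eq_abs, heq p.1 hp p.2 (hsub p.2 hp')]
    exact hdom p.1 hp p.2 (hsub p.2 hp')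
  exact integral_integral_swap hint

/-- **Integrability of the time integral.** Under the hypotheses of `ex_integrable_slice`,
`z ↦ ∫_{(0,t']} e(s, z) ds ∈ L¹(P)` for `t' ∈ [0, τ]`: it agrees a.e. with the strongly measurable
`z ↦ ∫_{(0,t']} G(s, z) ds` (`StronglyMeasurable.integral_prod_left'`) and is dominated by `vol((0,t']) · D`. -/
theorem ex_integrable_setIntegral_Ioc {α : Type*} [MeasurableSpace α] {P : Measure α} {g : Set α}
    (hg : P gᶜ = 0) {e : ℝ → α → ℝ} {G : ℝ × α → ℝ} {D : α → ℝ} (hG : Measurable G) {τ : ℝ}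
    (heq : ∀ z ∈ g, ∀ s ∈ Icc 0 τ, G (s, z) = e s z) (hD : Integrable D P)
    (hdom : ∀ z ∈ g, ∀ s ∈ Icc 0 τ, |e s z| ≤ D z) {t' : ℝ} (ht' : t' ∈ Icc 0 τ) :
    Integrable (fun z => ∫ s in Ioc 0 t', e s z) P := by
  have hae : ∀ᵐ z ∂P, z ∈ g := by rw [ae_iff]; exact hg
  have hsub : ∀ s ∈ Ioc 0 t', s ∈ Icc 0 τ := fun s hs => ⟨hs.1.le, hs.2.trans ht'.2⟩
  have hsm : StronglyMeasurable fun z => ∫ s in Ioc 0 t', G (s, z) :=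
    hG.stronglyMeasurable.integral_prod_left' (μ := volume.restrict (Ioc 0 t'))
  refine (hD.mul_const (volume.real (Ioc (0 : ℝ) t'))).mono' (hsm.aestronglyMeasurable.congr ?_) ?_
  · filter_upwards [hae] with z hz
    exact setIntegral_congr_fun measurableSet_Ioc fun s hs => heq z hz s (hsub s hs)
  · filter_upwards [hae] with z hz
    exact norm_setIntegral_le_of_norm_le_const measure_Ioc_lt_top fun s hs => by
      rw [Real.norm_eq_abs]
      exact hdom z hz s (hsub s hs)

/-! ### Concrete inputs: identification on the good set, conull good set, integrable domination -/

/-- **Identification.** On the good set and for `s ∈ [0, τ]` the time clamp `πs = max 0 (min s τ) = s` and the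
measurable version `Ψ` of the flow are invisible: `F(s, z) = e(s, z)`. -/
theorem ex_obsPsi_eq {N : ℕ}
    (Φ : HardSphereFlow (Literature.Analysis.FluidPDE.Torus.geometry (Fin 3)) (hsDiameter σ N) (N + 1))
    {Ψ : ℝ × Config (N + 1) (Fin 3) T3 → Config (N + 1) (Fin 3) T3}
    (hΨeq : ∀ (t : ℝ), ∀ z ∈ Φ.good, Ψ (t, z) = Φ.flow t z) (l a b : ℝ) {τ : ℝ}
    {z : Config (N + 1) (Fin 3) T3} (hz : z ∈ Φ.good) {s : ℝ} (hs : s ∈ Icc 0 τ) :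
    (fun p : ℝ × Config (N + 1) (Fin 3) T3 => ∫ x,
      clampedRelEnergy σ η₁ a b (ρ (max 0 (min p.1 τ)) x) (u (max 0 (min p.1 τ)) x) (θ (max 0 (min p.1 τ)) x)
        (boxState l (Ψ (max 0 (min p.1 τ), p.2)) x)) (s, z) = clampedRelEnergyObs σ η₁ a b ρ u θ N Φ l s z := by
  have h : max 0 (min s τ) = s := by rw [min_eq_left hs.2, max_eq_right hs.1]
  simp only [h, hΨeq s z hz, clampedRelEnergyObs]

/-- **The good set is conull for the local Gibbs law** (`P_N ≪ Liouville`, `HardSphereFlow.measure_compl_good`). -/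
theorem ex_measure_compl_good (a₀ : T3 → ℝ) (u₀ : T3 → V3) (θ₀ : T3 → ℝ) {N : ℕ}
    (Φ : HardSphereFlow (Literature.Analysis.FluidPDE.Torus.geometry (Fin 3)) (hsDiameter σ N) (N + 1)) :
    localGibbsLaw σ a₀ u₀ θ₀ N Φ Φ.goodᶜ = 0 := by
  rw [localGibbsLaw_eq]
  exact localGibbsMeasure_absolutelyContinuous σ a₀ u₀ θ₀ N Φ Φ.measure_compl_good

/-- **Integrable domination**: `z ↦ A + B · KE(z)/(N+1) ∈ L¹(P_N)` (`P_N` is a probability measure for `σ ≤ 1/2`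
and the kinetic energy is `P_N`-integrable, `EABirthS1a.integrable_configEnergy_localGibbsLaw`). -/
theorem ex_integrable_dom {a₀ θ₀ : T3 → ℝ} {u₀ : T3 → V3} (ha : Continuous a₀) (hθ : Continuous θ₀)
    (hu : Continuous u₀) (ha0 : ∀ x, 0 < a₀ x) (hθ0 : ∀ x, 0 < θ₀ x) (hσ2 : σ ≤ 1 / 2) {N : ℕ}
    (Φ : HardSphereFlow (Literature.Analysis.FluidPDE.Torus.geometry (Fin 3)) (hsDiameter σ N) (N + 1))
    (A B : ℝ) :
    Integrable (fun z => A + B * (((N : ℝ) + 1)⁻¹ * configEnergy z)) (localGibbsLaw σ a₀ u₀ θ₀ N Φ) := by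
  haveI := isProbabilityMeasure_localGibbsLaw ha hθ hu ha0 hθ0 hσ2 N Φ
  exact (integrable_const A).add
    (((EABirthS1a.integrable_configEnergy_localGibbsLaw ha hθ hu (fun x => (ha0 x).le) hθ0 σ N Φ).const_mul
      _).const_mul B)

variable (S : AnalyticOnNhd ℝ F (Ioo (-η₀) η₀) ∧ EqOn hsExcessFreeEnergy F (Ico 0 η₀) ∧ 0 < η₁ ∧ η₁ ≤ η₁B ∧
  2 * η₁B < η₀ ∧ 0 < σ ∧
  (∀ x, 0 < x → x * σ ^ 3 ≤ η₁B → f x = hsExcessFreeEnergy (x * σ ^ 3) ∧ χ x = hsCompressibility (x * σ ^ 3)) ∧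
  (EulerEOS.monatomicExcess χ f).IsGibbs ∧ IsHardSphereEulerSolution σ T ρ u θ ∧
  ∀ t ∈ Ico 0 T, ∀ x, ρ t x * σ ^ 3 ≤ η₁ / 2)
include S


/-- (E1) **Integrability of the clamped box energy observable under the local Gibbs law** at each time `s ∈ [0,τ]`,
given a jointly measurable version `Ψ` of the flow and the sharp domination `|e(s,z)| ≤ A + B·KE(z)/(N+1)` on the good set. -/
theorem sx_integrable_obs {a₀ θ₀ : T3 → ℝ} {u₀ : T3 → V3} (ha : Continuous a₀) (hθ : Continuous θ₀)
    (hu : Continuous u₀) (ha0 : ∀ x, 0 < a₀ x) (hθ0 : ∀ x, 0 < θ₀ x) (hσ2 : σ ≤ 1 / 2) {N : ℕ}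
    (Φ : HardSphereFlow (Literature.Analysis.FluidPDE.Torus.geometry (Fin 3)) (hsDiameter σ N) (N + 1))
    {Ψ : ℝ × Config (N + 1) (Fin 3) T3 → Config (N + 1) (Fin 3) T3} (hΨ : Measurable Ψ)
    (hΨeq : ∀ (t : ℝ), ∀ z ∈ Φ.good, Ψ (t, z) = Φ.flow t z) {l : ℝ} (hl : 0 < l) {a b : ℝ} (hab : a ≤ b)
    {τ : ℝ} (hτ : τ ∈ Ico 0 T) {A B : ℝ}
    (hAB : ∀ z ∈ Φ.good, ∀ s ∈ Icc 0 τ,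
      |clampedRelEnergyObs σ η₁ a b ρ u θ N Φ l s z| ≤ A + B * (((N : ℝ) + 1)⁻¹ * configEnergy z))
    {s : ℝ} (hs : s ∈ Icc 0 τ) :
    Integrable (fun z => clampedRelEnergyObs σ η₁ a b ρ u θ N Φ l s z) (localGibbsLaw σ a₀ u₀ θ₀ N Φ) := by
  have _ := hab
  exact ex_integrable_slice (ex_measure_compl_good a₀ u₀ θ₀ Φ) (sx_measurable_obsPsi S hΨ hl a b hτ)
    (fun z hz s hs => ex_obsPsi_eq Φ hΨeq l a b hz hs) (ex_integrable_dom ha hθ hu ha0 hθ0 hσ2 Φ A B) hAB hs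

/-- (E2) **Measurability in time of the mean clamped box energy** (time clamped to `[0,τ]`, flow read through `Ψ`). -/
theorem sx_measurable_mean {a₀ θ₀ : T3 → ℝ} {u₀ : T3 → V3} (ha : Continuous a₀) (hθ : Continuous θ₀)
    (hu : Continuous u₀) (ha0 : ∀ x, 0 < a₀ x) (hθ0 : ∀ x, 0 < θ₀ x) (hσ2 : σ ≤ 1 / 2) {N : ℕ}
    (Φ : HardSphereFlow (Literature.Analysis.FluidPDE.Torus.geometry (Fin 3)) (hsDiameter σ N) (N + 1))
    {Ψ : ℝ × Config (N + 1) (Fin 3) T3 → Config (N + 1) (Fin 3) T3} (hΨ : Measurable Ψ) {l : ℝ} (hl : 0 < l)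
    (a b : ℝ) {τ : ℝ} (hτ : τ ∈ Ico 0 T) :
    Measurable (fun t : ℝ => ∫ z, (∫ x, clampedRelEnergy σ η₁ a b (ρ (max 0 (min t τ)) x) (u (max 0 (min t τ)) x)
      (θ (max 0 (min t τ)) x) (boxState l (Ψ (max 0 (min t τ), z)) x)) ∂(localGibbsLaw σ a₀ u₀ θ₀ N Φ)) := by
  haveI := isProbabilityMeasure_localGibbsLaw ha hθ hu ha0 hθ0 hσ2 N Φ
  exact ((sx_measurable_obsPsi S hΨ hl a b hτ).stronglyMeasurable.integral_prod_right'
    (ν := localGibbsLaw σ a₀ u₀ θ₀ N Φ)).measurable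

/-- (E3) **Fubini for the time-integrated observable**: `E_P ∫_{(0,t']} e(s,·) ds = ∫_{(0,t']} E_P e(s,·) ds` for `t' ∈ [0,τ]`
(the inner mean written through `Ψ` and the time clamp, which are invisible on the good set and on `(0,t'] ⊆ [0,τ]`). -/
theorem sx_fubini_obs {a₀ θ₀ : T3 → ℝ} {u₀ : T3 → V3} (ha : Continuous a₀) (hθ : Continuous θ₀)
    (hu : Continuous u₀) (ha0 : ∀ x, 0 < a₀ x) (hθ0 : ∀ x, 0 < θ₀ x) (hσ2 : σ ≤ 1 / 2) {N : ℕ}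
    (Φ : HardSphereFlow (Literature.Analysis.FluidPDE.Torus.geometry (Fin 3)) (hsDiameter σ N) (N + 1))
    {Ψ : ℝ × Config (N + 1) (Fin 3) T3 → Config (N + 1) (Fin 3) T3} (hΨ : Measurable Ψ)
    (hΨeq : ∀ (t : ℝ), ∀ z ∈ Φ.good, Ψ (t, z) = Φ.flow t z) {l : ℝ} (hl : 0 < l) {a b : ℝ} (hab : a ≤ b)
    {τ : ℝ} (hτ : τ ∈ Ico 0 T) {A B : ℝ}
    (hAB : ∀ z ∈ Φ.good, ∀ s ∈ Icc 0 τ,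
      |clampedRelEnergyObs σ η₁ a b ρ u θ N Φ l s z| ≤ A + B * (((N : ℝ) + 1)⁻¹ * configEnergy z))
    {t' : ℝ} (ht' : t' ∈ Icc 0 τ) :
    ∫ z, (∫ s in Ioc 0 t', clampedRelEnergyObs σ η₁ a b ρ u θ N Φ l s z) ∂(localGibbsLaw σ a₀ u₀ θ₀ N Φ) =
      ∫ s in Ioc 0 t', ∫ z, (∫ x, clampedRelEnergy σ η₁ a b (ρ (max 0 (min s τ)) x) (u (max 0 (min s τ)) x)
        (θ (max 0 (min s τ)) x) (boxState l (Ψ (max 0 (min s τ), z)) x)) ∂(localGibbsLaw σ a₀ u₀ θ₀ N Φ) := by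
  have _ := hab
  haveI := isProbabilityMeasure_localGibbsLaw ha hθ hu ha0 hθ0 hσ2 N Φ
  exact ex_integral_integral_swap_Ioc (ex_measure_compl_good a₀ u₀ θ₀ Φ) (sx_measurable_obsPsi S hΨ hl a b hτ)
    (fun z hz s hs => ex_obsPsi_eq Φ hΨeq l a b hz hs) (ex_integrable_dom ha hθ hu ha0 hθ0 hσ2 Φ A B) hAB ht'

/-- (E4) **Integrability under the local Gibbs law of the time-integrated observable** `z ↦ ∫_{(0,t']} e(s,z) ds`,
`t' ∈ [0,τ]`. -/
theorem sx_integrable_timeIntegral_obs {a₀ θ₀ : T3 → ℝ} {u₀ : T3 → V3} (ha : Continuous a₀) (hθ : Continuous θ₀)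
    (hu : Continuous u₀) (ha0 : ∀ x, 0 < a₀ x) (hθ0 : ∀ x, 0 < θ₀ x) (hσ2 : σ ≤ 1 / 2) {N : ℕ}
    (Φ : HardSphereFlow (Literature.Analysis.FluidPDE.Torus.geometry (Fin 3)) (hsDiameter σ N) (N + 1))
    {Ψ : ℝ × Config (N + 1) (Fin 3) T3 → Config (N + 1) (Fin 3) T3} (hΨ : Measurable Ψ)
    (hΨeq : ∀ (t : ℝ), ∀ z ∈ Φ.good, Ψ (t, z) = Φ.flow t z) {l : ℝ} (hl : 0 < l) {a b : ℝ} (hab : a ≤ b)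
    {τ : ℝ} (hτ : τ ∈ Ico 0 T) {A B : ℝ}
    (hAB : ∀ z ∈ Φ.good, ∀ s ∈ Icc 0 τ,
      |clampedRelEnergyObs σ η₁ a b ρ u θ N Φ l s z| ≤ A + B * (((N : ℝ) + 1)⁻¹ * configEnergy z))
    {t' : ℝ} (ht' : t' ∈ Icc 0 τ) :
    Integrable (fun z => ∫ s in Ioc 0 t', clampedRelEnergyObs σ η₁ a b ρ u θ N Φ l s z)
      (localGibbsLaw σ a₀ u₀ θ₀ N Φ) := by
  have _ := hab
  exact ex_integrable_setIntegral_Ioc (ex_measure_compl_good a₀ u₀ θ₀ Φ) (sx_measurable_obsPsi S hΨ hl a b hτ)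
    (fun z hz s hs => ex_obsPsi_eq Φ hΨeq l a b hz hs) (ex_integrable_dom ha hθ hu ha0 hθ0 hσ2 Φ A B) hAB ht'

end Expect

end Summit.AtomisticToContinuum.HydrodynamicLimit.Theorems.RES

end
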